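import Literature.Analysis.FluidPDE.OseenHeatWeakDiv
import Literature.Analysis.FluidPDE.OseenSlice
import Literature.Analysis.FluidPDE.BoundedAnnihilator
import Literature.Analysis.FluidPDE.KatoUniqueness
import Literature.Analysis.FluidPDE.OseenDuhamelMeasurable
import Literature.Analysis.FluidPDE.NSBoundedMildOseen
import HarnessLib

/-!
# The two realisations of `e^{τΔ}P∇·` agree: the Oseen–heat operator on rank-one tensors is the
# Oseen–Koch–Tataru slice operator

Analysis/FluidPDE support file (everything proved; no definitions, no named facts) on the
discharge path of `Literature.Analysis.FluidPDE.KNSS2009_mild_regularity`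
(`KNSSRegularityGalilean.lean`; Koch–Nadirashvili–Seregin–Šverák, Acta Math. 203 (2009) =
arXiv:0709.3599v1, §4: Proposition 4.1 with (4.6), (4.8) and (4.11) for bounded mild solutions).
The tree carries **two** realisations of the operator `𝒩_τ = e^{τΔ}P∇·` acting on bounded tensors
(KNSS 2009, §3 (3.3)–(3.5): the representation formula `u(t) = S(t)u₀ + ∫₀ᵗ S(t−s)P∂ₖf_k ds`
with the kernel `K_{ijk}`):

* the **heat-flow realisation** `oseenHeat τ F i = ∑ⱼ ∂ⱼe^{τΔ}Fⱼᵢ + ∑ⱼₖ ∫₀^∞ ∂ᵢ∂ⱼ∂ₖe^{(τ+σ)Δ}Fⱼₖ dσ`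
  (`OseenHeat.lean`), in which the drift-mild class `IsKNSSDriftMild` of KNSS's §4 and hence the
  hypothesis of `KNSS2009_mild_regularity` are written (`driftDuhamel`,
  `KNSSRegularityDecomposition.lean`);
* the **kernel realisation** `oseenSlice σ a b x = ∫ K(σ, x − y)[a y, b y] dy` over the
  Oseen–Koch–Tataru kernel `K = oseenKernel` (`KochTataru.lean`, `OseenSlice.lean`), in which the
  tree's `L^∞` theory of the integral equation `u(t) = e^{ν(t−s)Δ}u(s) − B^ν_s(u,u)(t)`
  (`oseenDuhamel`, `NSBoundedMildOseen.lean`: restart, uniqueness `oseenMild_essBounded_unique`,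
  KNSS Prop. 4.1 as (P)/(L), the all-order bounds `exists_norm_iteratedFDeriv_oseenSlice_le`) is
  written.

This file proves that they coincide on rank-one tensors of bounded measurable fields in dimension
three (`sum_oseenHeat_smul_eq_oseenSlice`):

  `∑ᵢ (𝒩_τ[a ⊗ b])ᵢ(x) eᵢ = N_τ[a, b](x)`,   `(a ⊗ b)ⱼₖ = ⟪a, eⱼ⟫⟪b, e_k⟫`, `τ > 0`,

so that the Duhamel term of a zero-drift drift-mild field is the tree's `oseenDuhamel`
(`driftDuhamel_zero_eq_oseenDuhamel`) and **a drift-mild pair with zero drift is a bounded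
solution of the Oseen integral equation, pointwise**
(`IsKNSSDriftMild.eq_heatExtension_sub_oseenDuhamel`):
`V(t, x) = e^{(t−s)Δ}V(s)(x) − B¹_s(V, V)(t)(x)` for all `0 < s < t < T` and all `x`. This is the
entry point of the `oseenKernel`-side regularity theory into the proof of
`KNSS2009_mild_regularity`.

## The proof (no kernel calculus)

For fixed bounded measurable `a, b` let `w_τ = ∑ᵢ (𝒩_τ[a⊗b])ᵢ eᵢ − N_τ[a, b]`, `τ > 0`.
1. Both realisations are **weakly divergence free** (`isWeaklyDivFree_sum_oseenHeat_smul`,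
   `OseenHeatWeakDiv.lean`; `isWeaklyDivFree_oseenSlice` here, from the kernel identity
   `integral_inner_oseenKernel_comp_sub_gradient` of `KochTataruPairing.lean` by Fubini) and have
   the **same pairing with divergence-free test fields**, `−∫ ⟪b, D(e^{τΔ}φ)[a]⟫`
   (`sum_integral_oseenHeat_mul_inner_eq`; `integral_inner_oseenSlice_of_isDivFree` here, from
   `integral_inner_oseenKernel_comp_sub_of_isDivFree`). Hence `w_τ` is a bounded continuous weakly
   divergence-free field annihilating the solenoidal tests, i.e. **a constant** `c(τ)`
   (the `L^∞` annihilator lemma of `BoundedAnnihilator.lean`,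
   `IsWeaklyDivFree.exists_ae_eq_const_of_norm_le_of_forall_integral_inner_eq_zero`: "bounded
   solutions of `curl z = 0`, `div z = 0` are constant", KNSS Lemma 3.1 p. 7).
2. Both realisations are **semigroups in `τ`** (`heatExtension_oseenHeat`, `heatExtension_oseenSlice`),
   so `c(τ + t) = e^{tΔ}c(τ) = c(τ)`.
3. Both **decay** like `τ^{-1/2}` (`norm_oseenHeat_le_of_top`, `exists_norm_oseenSlice_le`), so
   `‖c(τ)‖ = ‖c(τ + t)‖ ≤ A (τ+t)^{-1/2} ≤ A t^{-1/2} → 0`: `c ≡ 0`.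
This is the rigorous form of KNSS's remark (§3 p. 6) that the Helmholtz projection is defined on
`L^∞` only modulo constants, "however, if the right-hand side is in divergence form, this
ambiguity is cancelled by the extra derivative".

## Mathlib / tree search

Tree (`lean search 'oseenHeat|oseenSlice|oseenKernel_comp_sub|exists_ae_eq_const'`): the eight
lemmas quoted above; `integrable_oseenKernel_slice_of_bound`, `norm_oseenKernel_apply_le_weight`,
`integrable_add_norm_sq_rpow_neg_half_succ`, `integral_add_norm_sq_rpow_neg_half_succ`,
`contDiff_oseenSlice`, `stronglyMeasurable_oseenSlice` (`OseenSlice`, `OseenKernelLp`);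
`memLp_top_oseenHeat`, `contDiff_oseenHeat`, `memLp_heatD1` (`OseenHeat(Semigroup)`);
`Measurable.oseenKernel_comp` (`KochTataruPointwise`); `heatExtension_const`,
`heatExtension_sub_of_bound` (`HeatKernelBoundedData`); `IsWeaklyDivFree.sub` (`KatoUniqueness`);
`driftTensor`, `driftDuhamel`, `IsKNSSDriftMild` (`KNSSRegularityDecomposition`),
`norm_sum_smul_stdOrthonormalBasis_le` (`OseenDuhamelMeasurable`); `oseenDuhamel`
(`NSBoundedMildOseen`). The docstring of `OseenHeatWeakDiv.lean` records that no
`oseenHeat ↔ oseenKernel` bridge existed. Mathlib: `integral_inner`, `integral_integral_swap`,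
`lintegral_prod`, `OrthonormalBasis.sum_inner_mul_inner`, `OrthonormalBasis.sum_repr'`,
`Continuous.ae_eq_iff_eq`, `tendsto_rpow_neg_atTop`, `ge_of_tendsto'`.

## References

* G. Koch, N. Nadirashvili, G. Seregin, V. Šverák, *Liouville theorems for the Navier–Stokes
  equations and applications*, Acta Math. 203 (2009) 83–105 = arXiv:0709.3599v1, §3 pp. 6–7
  ((3.3)–(3.5), the remark on `P` on `L^∞`, Lemma 3.1), §4 p. 8 ((4.3) `B(u,v)`).
  [KochNadirashviliSereginSverak2009]
* H. Koch, D. Tataru, *Well-posedness for the Navier–Stokes equations*, Adv. Math. 157 (2001),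
  §2 (8), §3 (11). [KochTataruAdvMath2001]
-/

noncomputable section

open MeasureTheory Set Function Filter TopologicalSpace InnerProductSpace Metric
open _root_.Topology
open scoped RealInnerProductSpace ENNReal NNReal

namespace Literature.Analysis.FluidPDE

variable {E : Type*} [NormedAddCommGroup E] [InnerProductSpace ℝ E] [FiniteDimensional ℝ E]
  [MeasurableSpace E] [BorelSpace E]

/-! ### The slice operator against test fields: Fubini, weak divergence-freeness, pairing -/

section SlicePairing

variable {σ : ℝ} {a b : E → E} {Ma Mb : ℝ}

/-- **The slice operator against a test field is the double integral of the tested kernel**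
(Fubini over `E × E` under the parabolic envelope `C M_a M_b (σ + ‖x − y‖²)^{-(d+1)/2} ‖w(x)‖`):
for bounded measurable `a, b`, `σ > 0` and a continuous compactly supported `w`,
`∫ ⟪N_σ[a,b](x), w(x)⟫ dx = ∫ (∫ ⟪K(σ, x − y)[a y, b y], w x⟫ dx) dy`. [folklore] -/
theorem integral_inner_oseenSlice_eq_integral_integral (hσ : 0 < σ) (ham : Measurable a)
    (hbm : Measurable b) (ha : ∀ y, ‖a y‖ ≤ Ma) (hb : ∀ y, ‖b y‖ ≤ Mb) {w : E → E}
    (hw : Continuous w) (hwc : HasCompactSupport w) :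
    Integrable (uncurry fun (x y : E) => ⟪oseenKernel σ (x - y) (a y) (b y), w x⟫)
        ((volume : Measure E).prod (volume : Measure E)) ∧
      ∫ x, ⟪oseenSlice σ a b x, w x⟫ = ∫ y, ∫ x, ⟪oseenKernel σ (x - y) (a y) (b y), w x⟫ := by
  obtain ⟨C, hC, hK⟩ := exists_norm_oseenKernel_le (E := E)
  have hMa : 0 ≤ Ma := (norm_nonneg _).trans (ha 0)
  have hMb : 0 ≤ Mb := (norm_nonneg _).trans (hb 0)
  set F : E → E → ℝ := fun x y => ⟪oseenKernel σ (x - y) (a y) (b y), w x⟫ with hF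
  -- measurability on `E × E`
  have hKm : Measurable (fun q : E × E => oseenKernel σ (q.1 - q.2) (a q.2) (b q.2)) :=
    Measurable.oseenKernel_comp measurable_const (measurable_fst.sub measurable_snd)
      (ham.comp measurable_snd) (hbm.comp measurable_snd)
  have hFm : AEStronglyMeasurable (uncurry F) ((volume : Measure E).prod (volume : Measure E)) :=
    (hKm.inner (hw.measurable.comp measurable_fst)).aestronglyMeasurable
  -- the envelope and its mass
  set env : E → ℝ := fun z => (σ + ‖z‖ ^ 2) ^ (-(((Module.finrank ℝ E : ℝ) + 1) / 2)) with henv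
  have henv_int : Integrable env := integrable_add_norm_sq_rpow_neg_half_succ (E := E) hσ
  have henv_nn : ∀ z, 0 ≤ env z := fun z => Real.rpow_nonneg (by positivity) _
  set I : ℝ := ∫ z, env z with hI
  have hI0 : 0 ≤ I := integral_nonneg henv_nn
  -- the `y`-integral of the norm of the kernel part is bounded uniformly in `x`
  have hinner : ∀ x, ∫⁻ y, ‖oseenKernel σ (x - y) (a y) (b y)‖ₑ ≤
      ENNReal.ofReal (C * Ma * Mb * I) := by
    intro x
    have hpt : ∀ y, ‖oseenKernel σ (x - y) (a y) (b y)‖ ≤ C * Ma * Mb * env (x - y) := fun y =>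
      norm_oseenKernel_apply_le_weight hK hC.le hσ ha hb x y
    have henvx : Integrable (fun y => C * Ma * Mb * env (x - y)) :=
      (henv_int.comp_sub_left x).const_mul _
    calc ∫⁻ y, ‖oseenKernel σ (x - y) (a y) (b y)‖ₑ
        ≤ ∫⁻ y, ENNReal.ofReal (C * Ma * Mb * env (x - y)) := by
          refine lintegral_mono fun y => ?_
          rw [← ofReal_norm]
          exact ENNReal.ofReal_le_ofReal (hpt y)
      _ = ENNReal.ofReal (∫ y, C * Ma * Mb * env (x - y)) := by
          rw [ofReal_integral_eq_lintegral_ofReal henvx (Eventually.of_forall fun y => by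
            simp only [Pi.zero_apply]
            have := henv_nn (x - y); positivity)]
      _ = ENNReal.ofReal (C * Ma * Mb * I) := by
          rw [integral_const_mul, integral_sub_left_eq_self env volume x]
  -- integrability on the product
  have hprod : Integrable (uncurry F) ((volume : Measure E).prod (volume : Measure E)) := by
    refine ⟨hFm, ?_⟩
    rw [hasFiniteIntegral_iff_enorm, lintegral_prod _ hFm.enorm]
    have hwi : ∫⁻ x, ‖w x‖ₑ ∂(volume : Measure E) < ∞ := (hw.integrable_of_hasCompactSupport hwc).2
    calc ∫⁻ x, ∫⁻ y, ‖uncurry F (x, y)‖ₑ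
        ≤ ∫⁻ x, ∫⁻ y, ‖oseenKernel σ (x - y) (a y) (b y)‖ₑ * ‖w x‖ₑ := by
          refine lintegral_mono fun x => lintegral_mono fun y => ?_
          simp only [uncurry_apply_pair, hF]
          rw [← ofReal_norm, ← ofReal_norm, ← ofReal_norm, ← ENNReal.ofReal_mul (norm_nonneg _)]
          refine ENNReal.ofReal_le_ofReal ?_
          rw [Real.norm_eq_abs]
          exact abs_real_inner_le_norm _ _
      _ = ∫⁻ x, (∫⁻ y, ‖oseenKernel σ (x - y) (a y) (b y)‖ₑ) * ‖w x‖ₑ := by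
          refine lintegral_congr fun x => ?_
          rw [lintegral_mul_const' _ _ enorm_ne_top]
      _ ≤ ∫⁻ x, ENNReal.ofReal (C * Ma * Mb * I) * ‖w x‖ₑ := by
          refine lintegral_mono fun x => ?_
          gcongr
          exact hinner x
      _ = ENNReal.ofReal (C * Ma * Mb * I) * ∫⁻ x, ‖w x‖ₑ :=
          lintegral_const_mul' _ _ ENNReal.ofReal_ne_top
      _ < ∞ := ENNReal.mul_lt_top ENNReal.ofReal_lt_top hwi
  refine ⟨hprod, ?_⟩
  have hpt : ∀ x, ⟪oseenSlice σ a b x, w x⟫ = ∫ y, F x y := by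
    intro x
    rw [oseenSlice_apply, real_inner_comm, ← integral_inner
      (integrable_oseenKernel_slice_of_bound hσ ham.aestronglyMeasurable hbm.aestronglyMeasurable
        ha hb x) (w x)]
    exact integral_congr_ae (Eventually.of_forall fun y => by
      simp only [hF]; exact real_inner_comm _ _)
  calc ∫ x, ⟪oseenSlice σ a b x, w x⟫ = ∫ x, ∫ y, F x y :=
        integral_congr_ae (Eventually.of_forall hpt)
    _ = ∫ y, ∫ x, F x y := integral_integral_swap hprod

/-- **The slice operator of bounded measurable fields is weakly divergence free** (`σ > 0`):
`∫ ⟪N_σ[a, b], ∇θ⟫ = 0` for every test function `θ` — the kernel of `e^{σΔ}P∇·` is divergence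
free in `z` (`integral_inner_oseenKernel_comp_sub_gradient`, Koch–Tataru 2001, §2 (5)–(8)),
inside the `y`-integral. [cite: KochTataruAdvMath2001, §2 (5)–(8)] -/
theorem isWeaklyDivFree_oseenSlice (hσ : 0 < σ) (ham : Measurable a) (hbm : Measurable b)
    (ha : ∀ y, ‖a y‖ ≤ Ma) (hb : ∀ y, ‖b y‖ ≤ Mb) : IsWeaklyDivFree (oseenSlice σ a b) := by
  haveI : CompleteSpace E := FiniteDimensional.complete ℝ E
  intro θ hθ
  have hθ1 : ContDiff ℝ 1 θ := hθ.contDiff.of_le (by exact_mod_cast le_top)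
  have hgc : Continuous (gradient θ) := continuous_gradient_of_contDiff hθ1
  have hgs : HasCompactSupport (gradient θ) :=
    (hθ.hasCompactSupport.fderiv (𝕜 := ℝ)).comp_left (g := (InnerProductSpace.toDual ℝ E).symm)
      (map_zero _)
  rw [(integral_inner_oseenSlice_eq_integral_integral hσ ham hbm ha hb hgc hgs).2]
  have h0 : ∀ y, ∫ x, ⟪oseenKernel σ (x - y) (a y) (b y), gradient θ x⟫ = 0 := fun y =>
    integral_inner_oseenKernel_comp_sub_gradient hσ y (a y) (b y) hθ
  have h1 : (fun y => ∫ x, ⟪oseenKernel σ (x - y) (a y) (b y), gradient θ x⟫) = fun _ => (0 : ℝ) :=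
    funext h0
  rw [h1, integral_zero]

/-- **The slice operator against a divergence-free test field** (the adjoint identity
`integral_inner_oseenKernel_comp_sub_of_isDivFree` inside the `y`-integral; Lemarié-Rieusset 2016,
Thm. 6.1, (6.12) ⇒ (6.11); KNSS 2009, (3.3)–(3.5): mild ⇒ weak): for `φ ∈ C_c^∞` with
`div φ = 0`, `∫ ⟪N_σ[a, b], φ⟫ = −∫ ⟪b(y), D(e^{σΔ}φ)(y)[a(y)]⟫ dy`. [cite: LemarieRieusset2016, Thm. 6.1 ((6.12) ⇒ (6.11))] -/
theorem integral_inner_oseenSlice_of_isDivFree (hσ : 0 < σ) (ham : Measurable a)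
    (hbm : Measurable b) (ha : ∀ y, ‖a y‖ ≤ Ma) (hb : ∀ y, ‖b y‖ ≤ Mb) {φ : E → E}
    (hφ : FunctionSpaces.IsTestFunctionOn (⊤ : Opens E) φ) (hdiv : VectorCalculus.IsDivFree φ) :
    ∫ x, ⟪oseenSlice σ a b x, φ x⟫ =
      -∫ y, ⟪b y, fderiv ℝ (UnboundedOperators.heatExtension φ σ) y (a y)⟫ := by
  rw [(integral_inner_oseenSlice_eq_integral_integral hσ ham hbm ha hb hφ.contDiff.continuous
    hφ.hasCompactSupport).2, ← integral_neg]
  refine integral_congr_ae (Eventually.of_forall fun y => ?_)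
  exact integral_inner_oseenKernel_comp_sub_of_isDivFree hσ y (a y) (b y) hφ hdiv

end SlicePairing

/-! ### The heat-flow realisation on rank-one tensors, in vector form -/

section HeatPairing

variable {a b : E → E} {Ma Mb : ℝ}
  {F : Fin (Module.finrank ℝ E) → Fin (Module.finrank ℝ E) → E → ℝ}

omit [MeasurableSpace E] [BorelSpace E] in
/-- Size of the frame components of a rank-one tensor: `|⟪a, eⱼ⟫⟪b, e_k⟫| ≤ ‖a‖ ‖b‖`. [folklore] -/
theorem abs_inner_frame_mul_inner_frame_le (u v : E) (j k : Fin (Module.finrank ℝ E)) :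
    |⟪u, stdOrthonormalBasis ℝ E j⟫ * ⟪v, stdOrthonormalBasis ℝ E k⟫| ≤ ‖u‖ * ‖v‖ := by
  rw [abs_mul]
  have h1 : |⟪u, stdOrthonormalBasis ℝ E j⟫| ≤ ‖u‖ := by
    refine (abs_real_inner_le_norm _ _).trans ?_
    rw [(stdOrthonormalBasis ℝ E).orthonormal.1 j, mul_one]
  have h2 : |⟪v, stdOrthonormalBasis ℝ E k⟫| ≤ ‖v‖ := by
    refine (abs_real_inner_le_norm _ _).trans ?_
    rw [(stdOrthonormalBasis ℝ E).orthonormal.1 k, mul_one]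
  exact mul_le_mul h1 h2 (abs_nonneg _) (norm_nonneg _)

/-- The frame components `⟪a, eⱼ⟫⟪b, e_k⟫` of the rank-one tensor of two bounded measurable
fields are bounded measurable (`L^∞`), with `‖·‖_∞ ≤ M_a M_b`. [folklore] -/
theorem memLp_top_rankOne (ham : Measurable a) (hbm : Measurable b) (ha : ∀ y, ‖a y‖ ≤ Ma)
    (hb : ∀ y, ‖b y‖ ≤ Mb)
    (hFab : ∀ j k y, F j k y = ⟪a y, stdOrthonormalBasis ℝ E j⟫ * ⟪b y, stdOrthonormalBasis ℝ E k⟫)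
    (j k : Fin (Module.finrank ℝ E)) :
    MemLp (F j k) ∞ volume ∧ eLpNorm (F j k) ∞ volume ≤ ENNReal.ofReal (Ma * Mb) := by
  have hMa : 0 ≤ Ma := (norm_nonneg _).trans (ha 0)
  have hfun : F j k = fun y => ⟪a y, stdOrthonormalBasis ℝ E j⟫ * ⟪b y, stdOrthonormalBasis ℝ E k⟫ :=
    funext (hFab j k)
  have hmeas : AEStronglyMeasurable (F j k) volume := by
    rw [hfun]
    exact ((ham.inner measurable_const).mul (hbm.inner measurable_const)).aestronglyMeasurable
  have hbd : ∀ y, ‖F j k y‖ ≤ Ma * Mb := fun y => by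
    rw [hFab, Real.norm_eq_abs]
    exact (abs_inner_frame_mul_inner_frame_le _ _ j k).trans
      (mul_le_mul (ha y) (hb y) (norm_nonneg _) hMa)
  refine ⟨memLp_top_of_bound hmeas _ (Eventually.of_forall hbd), ?_⟩
  rw [eLpNorm_exponent_top]
  exact eLpNormEssSup_le_of_ae_bound (Eventually.of_forall hbd)

/-- **Components of the derivative of the vector caloric extension of a test field**:
`heatD1 τ v ⟪φ, c⟫ (y) = ⟪D(e^{τΔ}φ)(y)[v], c⟫` for `φ ∈ C_c` (bounded continuous data: the
caloric extension commutes with `⟪·, c⟫`). [folklore] -/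
theorem heatD1_inner_const_eq_inner_fderiv_heatExtension {φ : E → E} (hφ : Continuous φ)
    (hφc : HasCompactSupport φ) {τ : ℝ} (hτ : 0 < τ) (c v y : E) :
    heatD1 τ v (fun z => ⟪φ z, c⟫) y =
      ⟪fderiv ℝ (UnboundedOperators.heatExtension φ τ) y v, c⟫ := by
  haveI : CompleteSpace E := FiniteDimensional.complete ℝ E
  obtain ⟨C, hC⟩ := (hφ.norm).bddAbove_range_of_hasCompactSupport hφc.norm
  have hC' : ∀ z, ‖φ z‖ ≤ C := fun z => hC (mem_range_self z)
  unfold heatD1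
  have hfun : UnboundedOperators.heatExtension (fun z => ⟪φ z, c⟫) τ =
      fun x => ⟪UnboundedOperators.heatExtension φ τ x, c⟫ := by
    funext x
    have h := UnboundedOperators.heatExtension_clm_comp_of_bound (innerSL ℝ c) hφ hC' hτ x
    simp only [innerSL_apply_apply] at h
    have e1 : (fun z => ⟪φ z, c⟫) = fun z => ⟪c, φ z⟫ := funext fun z => real_inner_comm _ _
    rw [e1, h, real_inner_comm]
  rw [hfun]
  have hmem : MemLp φ ∞ volume := memLp_top_of_bound hφ.aestronglyMeasurable C
    (Eventually.of_forall hC')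
  have hd : DifferentiableAt ℝ (UnboundedOperators.heatExtension φ τ) y :=
    ((UnboundedOperators.contDiff_heatExtension_holds hmem le_top hτ).differentiable (by simp)) y
  rw [fderiv_inner_apply ℝ hd (differentiableAt_const c)]
  simp [real_inner_comm]

variable (hE : Module.finrank ℝ E = 3)
include hE

/-- **The heat-flow realisation of `e^{τΔ}P∇·(a ⊗ b)` against a divergence-free test field**, in
vector form: for bounded measurable `a, b`, `τ > 0` and `φ ∈ C_c^∞`, `div φ = 0`,
`∫ ⟪∑ᵢ (𝒩_τ[a⊗b])ᵢ eᵢ, φ⟫ = −∫ ⟪b(y), D(e^{τΔ}φ)(y)[a(y)]⟫ dy` (the tree's componentwise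
`sum_integral_oseenHeat_mul_inner_eq`, reassembled along the frame by Parseval). [folklore] -/
theorem integral_inner_sum_oseenHeat_smul_of_isDivFree (ham : Measurable a) (hbm : Measurable b)
    (ha : ∀ y, ‖a y‖ ≤ Ma) (hb : ∀ y, ‖b y‖ ≤ Mb)
    (hFab : ∀ j k y, F j k y = ⟪a y, stdOrthonormalBasis ℝ E j⟫ * ⟪b y, stdOrthonormalBasis ℝ E k⟫)
    {τ : ℝ} (hτ : 0 < τ) {φ : E → E} (hφ : FunctionSpaces.IsTestFunctionOn (⊤ : Opens E) φ)
    (hdiv : VectorCalculus.IsDivFree φ) :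
    ∫ x, ⟪∑ i, oseenHeat τ F i x • stdOrthonormalBasis ℝ E i, φ x⟫ =
      -∫ y, ⟪b y, fderiv ℝ (UnboundedOperators.heatExtension φ τ) y (a y)⟫ := by
  set e := stdOrthonormalBasis ℝ E with he
  have hF : ∀ j k, MemLp (F j k) ∞ volume := fun j k => (memLp_top_rankOne ham hbm ha hb hFab j k).1
  have hφ1 : ContDiff ℝ 1 φ := hφ.contDiff.of_le (by exact_mod_cast le_top)
  have hφc : HasCompactSupport φ := hφ.hasCompactSupport
  have key := sum_integral_oseenHeat_mul_inner_eq hE hF hτ hφ1 hφc hdiv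
  -- the components of `φ`
  have hφi : ∀ i, Continuous fun x => ⟪φ x, e i⟫ := fun i => hφ1.continuous.inner continuous_const
  have hφic : ∀ i, HasCompactSupport fun x => ⟪φ x, e i⟫ := fun i =>
    hφc.comp_left (g := fun v => ⟪v, e i⟫) (inner_zero_left _)
  have hφint : ∀ i, Integrable fun x => ⟪φ x, e i⟫ := fun i =>
    (hφi i).integrable_of_hasCompactSupport (hφic i)
  -- left-hand side: the sum through the integral
  have hL : ∫ x, ⟪∑ i, oseenHeat τ F i x • e i, φ x⟫ =
      ∑ i, ∫ x, oseenHeat τ F i x * ⟪φ x, e i⟫ := by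
    have hint : ∀ i, Integrable fun x => oseenHeat τ F i x * ⟪φ x, e i⟫ := by
      intro i
      obtain ⟨B, hB0, hB⟩ := exists_componentwise_bound hF
      exact (hφint i).bdd_mul (aestronglyMeasurable_oseenHeat hE hF hτ i)
        (Eventually.of_forall fun x => norm_oseenHeat_le_of_top hE hF hB0 hB hτ i x)
    rw [← integral_finsetSum _ fun i _ => hint i]
    refine integral_congr_ae (Eventually.of_forall fun x => ?_)
    dsimp only
    rw [sum_inner]
    refine Finset.sum_congr rfl fun i _ => ?_
    rw [real_inner_smul_left, real_inner_comm]
  -- right-hand side: the double sum is the tested transport term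
  have hD1int : ∀ i j, Integrable fun y => F j i y * heatD1 τ (e j) (fun x => ⟪φ x, e i⟫) y := by
    intro i j
    have hm1 : MemLp (heatD1 τ (e j) (fun x => ⟪φ x, e i⟫)) 1 volume :=
      memLp_heatD1 (memLp_one_iff_integrable.2 (hφint i)) le_rfl hτ (e j)
    have hint1 : Integrable (heatD1 τ (e j) (fun x => ⟪φ x, e i⟫)) :=
      memLp_one_iff_integrable.1 hm1
    have hMa : 0 ≤ Ma := (norm_nonneg _).trans (ha 0)
    refine hint1.bdd_mul (c := Ma * Mb) (hF j i).1 (Eventually.of_forall fun y => ?_)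
    rw [hFab, Real.norm_eq_abs]
    exact (abs_inner_frame_mul_inner_frame_le _ _ j i).trans
      (mul_le_mul (ha y) (hb y) (norm_nonneg _) hMa)
  have hR : ∑ i, ∑ j, ∫ y, F j i y * heatD1 τ (e j) (fun x => ⟪φ x, e i⟫) y =
      ∫ y, ⟪b y, fderiv ℝ (UnboundedOperators.heatExtension φ τ) y (a y)⟫ := by
    have h1 : ∀ i, ∑ j, ∫ y, F j i y * heatD1 τ (e j) (fun x => ⟪φ x, e i⟫) y =
        ∫ y, ∑ j, F j i y * heatD1 τ (e j) (fun x => ⟪φ x, e i⟫) y := fun i =>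
      (integral_finsetSum _ fun j _ => hD1int i j).symm
    simp_rw [h1]
    rw [← integral_finsetSum _ fun i _ => integrable_finsetSum _ fun j _ => hD1int i j]
    refine integral_congr_ae (Eventually.of_forall fun y => ?_)
    -- pointwise: `∑ᵢⱼ aⱼ bᵢ ⟪D(e^{τΔ}φ)[eⱼ], eᵢ⟫ = ⟪b, D(e^{τΔ}φ)[a]⟫`
    set D : E →L[ℝ] E := fderiv ℝ (UnboundedOperators.heatExtension φ τ) y with hD
    have hcomp : ∀ i j, F j i y * heatD1 τ (e j) (fun x => ⟪φ x, e i⟫) y =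
        ⟪b y, e i⟫ * (⟪a y, e j⟫ * ⟪D (e j), e i⟫) := by
      intro i j
      rw [hFab, heatD1_inner_const_eq_inner_fderiv_heatExtension hφ1.continuous hφc hτ]
      ring
    simp_rw [hcomp, ← Finset.mul_sum]
    have hexp : a y = ∑ j, ⟪a y, e j⟫ • e j := by
      conv_lhs => rw [← (stdOrthonormalBasis ℝ E).sum_repr' (a y)]
      exact Finset.sum_congr rfl fun j _ => by rw [real_inner_comm]
    have hlin : ∀ i, ∑ j, ⟪a y, e j⟫ * ⟪D (e j), e i⟫ = ⟪D (a y), e i⟫ := by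
      intro i
      conv_rhs => rw [hexp]
      rw [map_sum, sum_inner]
      refine Finset.sum_congr rfl fun j _ => ?_
      rw [map_smul, real_inner_smul_left]
    simp_rw [hlin]
    calc ∑ i, ⟪b y, e i⟫ * ⟪D (a y), e i⟫ = ∑ i, ⟪b y, e i⟫ * ⟪e i, D (a y)⟫ :=
          Finset.sum_congr rfl fun i _ => by rw [real_inner_comm (e i) (D (a y))]
      _ = ⟪b y, D (a y)⟫ := (stdOrthonormalBasis ℝ E).sum_inner_mul_inner _ _
  rw [hL, key, hR]

end HeatPairing

/-! ### The bridge -/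

section Bridge

variable {a b : E → E} {Ma Mb : ℝ}
  {F : Fin (Module.finrank ℝ E) → Fin (Module.finrank ℝ E) → E → ℝ}

/-- The vector caloric extension of a frame combination of bounded continuous scalar fields is
the frame combination of the scalar caloric extensions. [folklore] -/
theorem heatExtension_sum_smul_frame {g : Fin (Module.finrank ℝ E) → E → ℝ}
    (hg : ∀ i, Continuous (g i)) {C : ℝ} (hC : ∀ i z, ‖g i z‖ ≤ C) {t : ℝ} (ht : 0 < t) (x : E) :
    UnboundedOperators.heatExtension (fun z => ∑ i, g i z • stdOrthonormalBasis ℝ E i) t x =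
      ∑ i, UnboundedOperators.heatExtension (g i) t x • stdOrthonormalBasis ℝ E i := by
  have hint : ∀ i, Integrable (fun y => UnboundedOperators.heatKernel t y * g i (x - y)) := by
    intro i
    have hm : AEStronglyMeasurable (fun y => UnboundedOperators.heatKernel t y * g i (x - y)) volume :=
      ((UnboundedOperators.continuous_heatKernel t).mul
        ((hg i).comp (continuous_const.sub continuous_id))).aestronglyMeasurable
    refine (((UnboundedOperators.integrable_heatKernel_holds ht).norm).mul_const C).mono' hm
      (Eventually.of_forall fun y => ?_)
    rw [norm_mul]
    exact mul_le_mul_of_nonneg_left (hC i _) (norm_nonneg _)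
  rw [UnboundedOperators.heatExtension_apply]
  simp_rw [Finset.smul_sum, ← smul_assoc, smul_eq_mul]
  rw [integral_finsetSum _ fun i _ => (hint i).smul_const _]
  refine Finset.sum_congr rfl fun i _ => ?_
  rw [integral_smul_const, UnboundedOperators.heatExtension_apply]
  rfl

variable (hE : Module.finrank ℝ E = 3)
include hE

/-- **The two realisations of `e^{τΔ}P∇·` agree on rank-one tensors** (dimension three): for
bounded measurable fields `a, b` and `τ > 0`,
`∑ᵢ (𝒩_τ[a ⊗ b])ᵢ(x) eᵢ = N_τ[a, b](x) = ∫ K(τ, x − y)[a y, b y] dy`, where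
`(a ⊗ b)ⱼₖ = ⟪a, eⱼ⟫⟪b, e_k⟫`, `𝒩_τ = oseenHeat τ` is the heat-flow realisation and `N_τ = oseenSlice τ`
the Oseen–Koch–Tataru kernel realisation (KNSS 2009, §3 (3.3) = (3.5): the abstract
`S(t−s)P∂ₖf_k` and the kernel `K_{ijk}` forms of the representation formula). Proof: the
difference is a bounded continuous weakly divergence-free field annihilating the solenoidal tests,
hence a constant `c(τ)`; both sides are semigroups in `τ` and decay like `τ^{-1/2}`, so
`c(τ) = c(τ + t) → 0`. [cite: KochNadirashviliSereginSverak2009, §3 (3.3)–(3.5) and the remark on P on L^∞ (arXiv:0709.3599v1 p. 6)] -/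
theorem sum_oseenHeat_smul_eq_oseenSlice (ham : Measurable a) (hbm : Measurable b)
    (ha : ∀ y, ‖a y‖ ≤ Ma) (hb : ∀ y, ‖b y‖ ≤ Mb)
    (hFab : ∀ j k y, F j k y = ⟪a y, stdOrthonormalBasis ℝ E j⟫ * ⟪b y, stdOrthonormalBasis ℝ E k⟫)
    {τ : ℝ} (hτ : 0 < τ) (x : E) :
    ∑ i, oseenHeat τ F i x • stdOrthonormalBasis ℝ E i = oseenSlice τ a b x := by
  haveI : CompleteSpace E := FiniteDimensional.complete ℝ E
  set e := stdOrthonormalBasis ℝ E with he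
  have hMa : 0 ≤ Ma := (norm_nonneg _).trans (ha 0)
  have hMb : 0 ≤ Mb := (norm_nonneg _).trans (hb 0)
  have hF : ∀ j k, MemLp (F j k) ∞ volume := fun j k => (memLp_top_rankOne ham hbm ha hb hFab j k).1
  have hFB : ∀ j k, eLpNorm (F j k) ∞ volume ≤ ENNReal.ofReal (Ma * Mb) := fun j k =>
    (memLp_top_rankOne ham hbm ha hb hFab j k).2
  obtain ⟨C₀, hC₀, hN⟩ := exists_norm_oseenSlice_le (E := E)
  -- the two fields and their difference, for every clock `ρ > 0`
  set u : ℝ → E → E := fun ρ z => ∑ i, oseenHeat ρ F i z • e i with hu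
  set v : ℝ → E → E := fun ρ z => oseenSlice ρ a b z with hv
  set w : ℝ → E → E := fun ρ z => u ρ z - v ρ z with hw
  -- the decay constant
  set A : ℝ := (Module.finrank ℝ E) * (2943 * (Ma * Mb)) + C₀ * Ma * Mb with hA
  have hA0 : 0 ≤ A := by positivity
  -- bounds
  have hu_bd : ∀ {ρ : ℝ}, 0 < ρ → ∀ z, ‖u ρ z‖ ≤ (Module.finrank ℝ E) * (2943 * (Ma * Mb)) *
      ρ ^ (-(1 / 2 : ℝ)) := by
    intro ρ hρ z
    simp only [hu]
    refine (norm_sum_smul_stdOrthonormalBasis_le _).trans ?_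
    calc ∑ i, |oseenHeat ρ F i z| ≤ ∑ _i : Fin (Module.finrank ℝ E), 2943 * ρ ^ (-(1 / 2 : ℝ)) * (Ma * Mb) :=
          Finset.sum_le_sum fun i _ => by
            rw [← Real.norm_eq_abs]; exact norm_oseenHeat_le_of_top hE hF (by positivity) hFB hρ i z
      _ = (Module.finrank ℝ E) * (2943 * (Ma * Mb)) * ρ ^ (-(1 / 2 : ℝ)) := by
          rw [Finset.sum_const, Finset.card_univ, Fintype.card_fin, nsmul_eq_mul]; ring
  have hv_bd : ∀ {ρ : ℝ}, 0 < ρ → ∀ z, ‖v ρ z‖ ≤ C₀ * Ma * Mb * ρ ^ (-(1 / 2 : ℝ)) := by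
    intro ρ hρ z
    simp only [hv]
    calc ‖oseenSlice ρ a b z‖ ≤ C₀ * ρ ^ (-(1 / 2 : ℝ)) * Ma * Mb := hN hρ ha hb z
      _ = C₀ * Ma * Mb * ρ ^ (-(1 / 2 : ℝ)) := by ring
  have hw_bd : ∀ {ρ : ℝ}, 0 < ρ → ∀ z, ‖w ρ z‖ ≤ A * ρ ^ (-(1 / 2 : ℝ)) := by
    intro ρ hρ z
    simp only [hw]
    calc ‖u ρ z - v ρ z‖ ≤ ‖u ρ z‖ + ‖v ρ z‖ := norm_sub_le _ _
      _ ≤ (Module.finrank ℝ E) * (2943 * (Ma * Mb)) * ρ ^ (-(1 / 2 : ℝ)) +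
            C₀ * Ma * Mb * ρ ^ (-(1 / 2 : ℝ)) := add_le_add (hu_bd hρ z) (hv_bd hρ z)
      _ = A * ρ ^ (-(1 / 2 : ℝ)) := by rw [hA]; ring
  -- continuity
  have hu_cont : ∀ {ρ : ℝ}, 0 < ρ → Continuous (u ρ) := by
    intro ρ hρ
    simp only [hu]
    refine continuous_finsetSum _ fun i _ => ?_
    exact (contDiff_oseenHeat hE hF hρ i (n := 0)).continuous.smul continuous_const
  have hv_cont : ∀ {ρ : ℝ}, 0 < ρ → Continuous (v ρ) := fun {ρ} hρ =>
    (contDiff_oseenSlice hρ ham hbm ha hb (n := 0)).continuous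
  have hw_cont : ∀ {ρ : ℝ}, 0 < ρ → Continuous (w ρ) := fun {ρ} hρ =>
    (hu_cont hρ).sub (hv_cont hρ)
  -- Step 1: the difference is a constant field
  have hconst : ∀ {ρ : ℝ}, 0 < ρ → ∃ c : E, ∀ z, w ρ z = c := by
    intro ρ hρ
    have hum : MemLp (u ρ) ∞ volume := memLp_top_of_bound (hu_cont hρ).aestronglyMeasurable _
      (Eventually.of_forall (hu_bd hρ))
    have hvm : MemLp (v ρ) ∞ volume := memLp_top_of_bound (hv_cont hρ).aestronglyMeasurable _
      (Eventually.of_forall (hv_bd hρ))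
    have hdiv_u : IsWeaklyDivFree (u ρ) := isWeaklyDivFree_sum_oseenHeat_smul hE hF hρ
    have hdiv_v : IsWeaklyDivFree (v ρ) := isWeaklyDivFree_oseenSlice hρ ham hbm ha hb
    have hdiv_w : IsWeaklyDivFree (w ρ) := IsWeaklyDivFree.sub le_top hdiv_u hdiv_v hum hvm
    have horth : ∀ φ : E → E, FunctionSpaces.IsTestFunctionOn (⊤ : Opens E) φ →
        VectorCalculus.IsDivFree φ → ∫ z, ⟪w ρ z, φ z⟫ = 0 := by
      intro φ hφ hφdiv
      have hφc := hφ.hasCompactSupport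
      have hφcont := hφ.contDiff.continuous
      have hint_u : Integrable fun z => ⟪u ρ z, φ z⟫ := by
        have h1 : Integrable fun z => ‖φ z‖ := (hφcont.norm).integrable_of_hasCompactSupport hφc.norm
        refine ((h1.const_mul ((Module.finrank ℝ E) * (2943 * (Ma * Mb)) * ρ ^ (-(1 / 2 : ℝ)))).mono'
          ((hu_cont hρ).inner hφcont).aestronglyMeasurable (Eventually.of_forall fun z => ?_))
        rw [Real.norm_eq_abs]
        exact (abs_real_inner_le_norm _ _).trans (mul_le_mul_of_nonneg_right (hu_bd hρ z) (norm_nonneg _))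
      have hint_v : Integrable fun z => ⟪v ρ z, φ z⟫ := by
        have h1 : Integrable fun z => ‖φ z‖ := (hφcont.norm).integrable_of_hasCompactSupport hφc.norm
        refine ((h1.const_mul (C₀ * Ma * Mb * ρ ^ (-(1 / 2 : ℝ)))).mono'
          ((hv_cont hρ).inner hφcont).aestronglyMeasurable (Eventually.of_forall fun z => ?_))
        rw [Real.norm_eq_abs]
        exact (abs_real_inner_le_norm _ _).trans (mul_le_mul_of_nonneg_right (hv_bd hρ z) (norm_nonneg _))
      have hsplit : ∫ z, ⟪w ρ z, φ z⟫ = (∫ z, ⟪u ρ z, φ z⟫) - ∫ z, ⟪v ρ z, φ z⟫ := by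
        rw [← integral_sub hint_u hint_v]
        refine integral_congr_ae (Eventually.of_forall fun z => ?_)
        simp only [hw, inner_sub_left]
      rw [hsplit]
      simp only [hu, hv]
      rw [integral_inner_sum_oseenHeat_smul_of_isDivFree hE ham hbm ha hb hFab hρ hφ hφdiv,
        integral_inner_oseenSlice_of_isDivFree hρ ham hbm ha hb hφ hφdiv, sub_self]
    obtain ⟨c, hc⟩ :=
      IsWeaklyDivFree.exists_ae_eq_const_of_norm_le_of_forall_integral_inner_eq_zero
        (hw_cont hρ).aestronglyMeasurable (hw_bd hρ) hdiv_w horth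
    refine ⟨c, fun z => ?_⟩
    have heq : w ρ = fun _ => c := ((hw_cont hρ).ae_eq_iff_eq volume continuous_const).1 hc
    exact congr_fun heq z
  -- Step 2: the semigroup law for the difference
  have hsemi : ∀ {ρ t : ℝ}, 0 < ρ → 0 < t → ∀ z,
      w (ρ + t) z = UnboundedOperators.heatExtension (w ρ) t z := by
    intro ρ t hρ ht z
    have hsub : UnboundedOperators.heatExtension (w ρ) t z =
        UnboundedOperators.heatExtension (u ρ) t z - UnboundedOperators.heatExtension (v ρ) t z :=
      UnboundedOperators.heatExtension_sub_of_bound (hu_cont hρ) (hv_cont hρ) (hu_bd hρ) (hv_bd hρ)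
        ht z
    rw [hsub]
    have hU : UnboundedOperators.heatExtension (u ρ) t z = u (ρ + t) z := by
      simp only [hu]
      rw [heatExtension_sum_smul_frame (fun i => (contDiff_oseenHeat hE hF hρ i (n := 0)).continuous)
        (C := 2943 * ρ ^ (-(1 / 2 : ℝ)) * (Ma * Mb))
        (fun i y => norm_oseenHeat_le_of_top hE hF (by positivity) hFB hρ i y) ht z]
      refine Finset.sum_congr rfl fun i _ => ?_
      rw [heatExtension_oseenHeat hE hF ht hρ i z, add_comm]
    have hV : UnboundedOperators.heatExtension (v ρ) t z = v (ρ + t) z := by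
      simp only [hv]
      exact heatExtension_oseenSlice hρ ht ham hbm ha hb z
    rw [hU, hV]
  -- Step 3: the constant vanishes
  have hzero : ∀ {ρ : ℝ}, 0 < ρ → ∀ z, w ρ z = 0 := by
    intro ρ hρ z
    obtain ⟨c, hc⟩ := hconst hρ
    -- `c = c(ρ + t)` and `‖c(ρ + t)‖ ≤ A t^{-1/2}` for all `t > 0`
    have hct : ∀ {t : ℝ}, 0 < t → ‖c‖ ≤ A * t ^ (-(1 / 2 : ℝ)) := by
      intro t ht
      have h1 : w (ρ + t) 0 = c := by
        rw [hsemi hρ ht 0]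
        have : w ρ = fun _ => c := funext hc
        rw [this, UnboundedOperators.heatExtension_const c ht]
      calc ‖c‖ = ‖w (ρ + t) 0‖ := by rw [h1]
        _ ≤ A * (ρ + t) ^ (-(1 / 2 : ℝ)) := hw_bd (by linarith) 0
        _ ≤ A * t ^ (-(1 / 2 : ℝ)) := by
            refine mul_le_mul_of_nonneg_left ?_ hA0
            exact Real.rpow_le_rpow_of_nonpos ht (by linarith) (by norm_num)
    have hlim : Tendsto (fun t : ℝ => A * t ^ (-(1 / 2 : ℝ))) atTop (𝓝 0) := by
      have := (tendsto_rpow_neg_atTop (by norm_num : (0 : ℝ) < 1 / 2)).const_mul A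
      rw [mul_zero] at this
      exact this
    have hle : ‖c‖ ≤ 0 :=
      ge_of_tendsto hlim (Filter.eventually_atTop.2 ⟨1, fun t ht => hct (by linarith)⟩)
    have hc0 : c = 0 := norm_le_zero_iff.1 hle
    rw [hc z, hc0]
  have := hzero hτ x
  simp only [hw, hu, hv, sub_eq_zero] at this
  exact this

/-- Componentwise form of the bridge: `(𝒩_τ[a ⊗ b])ᵢ(x) = ⟪N_τ[a, b](x), eᵢ⟫`. [cite: KochNadirashviliSereginSverak2009, §3 (3.3)–(3.5) (arXiv:0709.3599v1 p. 6)] -/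
theorem oseenHeat_eq_inner_oseenSlice (ham : Measurable a) (hbm : Measurable b)
    (ha : ∀ y, ‖a y‖ ≤ Ma) (hb : ∀ y, ‖b y‖ ≤ Mb)
    (hFab : ∀ j k y, F j k y = ⟪a y, stdOrthonormalBasis ℝ E j⟫ * ⟪b y, stdOrthonormalBasis ℝ E k⟫)
    {τ : ℝ} (hτ : 0 < τ) (i : Fin (Module.finrank ℝ E)) (x : E) :
    oseenHeat τ F i x = ⟪oseenSlice τ a b x, stdOrthonormalBasis ℝ E i⟫ := by
  rw [← sum_oseenHeat_smul_eq_oseenSlice hE ham hbm ha hb hFab hτ x, sum_inner]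
  simp_rw [real_inner_smul_left]
  rw [Finset.sum_eq_single i]
  · rw [real_inner_self_eq_norm_sq, (stdOrthonormalBasis ℝ E).orthonormal.1 i]; ring
  · intro j _ hji
    rw [(stdOrthonormalBasis ℝ E).orthonormal.2 hji, mul_zero]
  · intro h; exact absurd (Finset.mem_univ i) h

/-! ### Drift-mild pairs with zero drift solve the Oseen integral equation -/

/-- **The Duhamel term of a zero-drift drift-mild field is the tree's `oseenDuhamel`**:
`∫ₛᵗ ∑ᵢ (𝒩_{t−σ}[V(σ) ⊗ V(σ)])ᵢ(x) eᵢ dσ = B¹_s(V, V)(t)(x)` for `s ≤ t` and slices `V(σ)`,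
`σ ∈ (s, t)`, measurable and bounded by `N` (KNSS 2009, (4.3): `B(u,v)ᵢ = −∫∫ K_{ijk} u_k v_j`,
in the two realisations). [cite: KochNadirashviliSereginSverak2009, §4 (4.3) (arXiv:0709.3599v1 p. 8)] -/
theorem driftDuhamel_zero_eq_oseenDuhamel {V : ℝ → E → E} {s t N : ℝ}
    (hVm : ∀ σ ∈ Ioo s t, Measurable (V σ)) (hVN : ∀ σ ∈ Ioo s t, ∀ y, ‖V σ y‖ ≤ N)
    (hst : s ≤ t) (x : E) :
    driftDuhamel V 0 s t x = oseenDuhamel 1 s V V t x := by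
  rw [driftDuhamel_apply, oseenDuhamel_apply, intervalIntegral.integral_of_le hst,
    integral_Ioc_eq_integral_Ioo]
  refine setIntegral_congr_fun measurableSet_Ioo fun σ hσ => ?_
  have hF : ∀ j k y, driftTensor V 0 σ j k y =
      ⟪V σ y, stdOrthonormalBasis ℝ E j⟫ * ⟪V σ y, stdOrthonormalBasis ℝ E k⟫ := fun j k y => by
    simp [driftTensor]
  rw [sum_oseenHeat_smul_eq_oseenSlice hE (hVm σ hσ) (hVm σ hσ) (hVN σ hσ) (hVN σ hσ) hF
    (sub_pos.2 hσ.2) x, oseenSlice_apply, one_mul]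

/-- **A drift-mild pair with zero drift is a bounded solution of the Oseen integral equation,
pointwise**: if `IsKNSSDriftMild T N V 0` (KNSS 2009, §4 (i): a bounded mild solution of
Navier–Stokes on `(0, T)`, restarted at every `s`, heat-flow realisation), then for all
`0 < s < t < T` and all `x`, `V(t, x) = e^{(t−s)Δ}V(s)(x) − B¹_s(V, V)(t)(x)` with the tree's
kernel-realised Duhamel term `oseenDuhamel` (KNSS (4.4), `u = U + B(u,u)`). [cite: KochNadirashviliSereginSverak2009, §4 (i) and (4.3)–(4.4) (arXiv:0709.3599v1 p. 8)] -/
theorem IsKNSSDriftMild.eq_heatExtension_sub_oseenDuhamel {T N : ℝ} {V : ℝ → E → E}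
    (h : IsKNSSDriftMild T N V 0) {s t : ℝ} (hs : 0 < s) (hst : s < t) (htT : t < T) (x : E) :
    V t x = UnboundedOperators.heatExtension (V s) (t - s) x - oseenDuhamel 1 s V V t x := by
  have hVm : ∀ σ ∈ Ioo s t, Measurable (V σ) := fun σ _ =>
    h.measurable.comp (measurable_const.prodMk measurable_id)
  have hVN : ∀ σ ∈ Ioo s t, ∀ y, ‖V σ y‖ ≤ N := fun σ hσ y =>
    h.norm_le σ ⟨hs.trans hσ.1, hσ.2.trans htT⟩ y
  rw [h.mild s t hs hst htT x, driftDuhamel_zero_eq_oseenDuhamel hE hVm hVN hst.le x]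

omit hE in
/-- `ℝ³` form of `IsKNSSDriftMild.eq_heatExtension_sub_oseenDuhamel`: a zero-drift drift-mild
field on `ℝ³ × (0, T)` solves `V(t) = e^{(t−s)Δ}V(s) − B¹_s(V,V)(t)` pointwise, hence a.e., for
all `0 < s < t < T` — the hypothesis of the tree's `L^∞` Oseen theory ((R) `oseenMild_restart`,
(P) `knss2009_smoothing`, `oseenMild_essBounded_unique`). [cite: KochNadirashviliSereginSverak2009, §4 (i) and (4.3)–(4.4) (arXiv:0709.3599v1 p. 8)] -/
theorem IsKNSSDriftMild.eq_heatExtension_sub_oseenDuhamel_three {T N : ℝ}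
    {V : ℝ → EuclideanSpace ℝ (Fin 3) → EuclideanSpace ℝ (Fin 3)} (h : IsKNSSDriftMild T N V 0)
    {s t : ℝ} (hs : 0 < s) (hst : s < t) (htT : t < T) :
    (∀ x, V t x = UnboundedOperators.heatExtension (V s) (t - s) x - oseenDuhamel 1 s V V t x) ∧
      V t =ᵐ[volume] fun x =>
        UnboundedOperators.heatExtension (V s) (1 * (t - s)) x - oseenDuhamel 1 s V V t x := by
  have hE : Module.finrank ℝ (EuclideanSpace ℝ (Fin 3)) = 3 := finrank_euclideanSpace_fin
  have hpt := fun x => h.eq_heatExtension_sub_oseenDuhamel hE hs hst htT x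
  refine ⟨hpt, Eventually.of_forall fun x => ?_⟩
  rw [one_mul]
  exact hpt x

end Bridge

end Literature.Analysis.FluidPDE

end
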